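import Literature.Analysis.FluidPDE.TaoCascadeDuhamel

/-!
# `PumpTransfer` (stmt-NavierStokesRegularity-1837), line `Sketch`: structure of any witness of `stub_rayTypeI`

Negative-side support lemmas (cdisprove seat, cycle 1) about the lead's research stub `stub_rayTypeI`
(skeleton v2, 2026-08-16T08:46Z): a cascade circuit (`CascadeWaveletData ε₀ m`, symmetric cancelling `α`)
and a ray datum `A • ψ_{i₀,n₀}` whose LIFTED VOLTERRA solution
`X_{i,n}(t) = ∫ duhamelScalar (A·δ_{(i,n),(i₀,n₀)}) (quadTerm ∘ X) (4π²|ξ|²) t · |ψ̂_{i,n}(ξ)|² dξ`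
(i) exists up to `T*`, (ii) has no `H¹⁰`-weight-bounded continuation past `T*`, (iii) obeys a Type-I fibre sum.

Proved here (small models of the stub, in tree vocabulary only — no route item is mentioned):
* `volterra_zero_solution`: with `A = 0` the zero coefficient field solves the lifted Volterra system for every
  circuit, identically in `t` (`quadTerm` vanishes on `0`, `duhamelScalar 0 0 = 0`);
* `rayTypeI_clause_ii_fails_at_zero`: hence at `A = 0` the non-extension clause (ii) FAILS on every `[0,S)` —
  any witness of the stub has `A ≠ 0`;
* `rayTypeI_clause_ii_fails_at_m_zero`: with `m = 0` (no modes) the empty field solves everything — any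
  witness has `m ≥ 1`.
Cheap, but they pin the degenerate corners a prover's construction must avoid, and they are the only
unconditional facts about the stub available without settling the threshold classification it encodes
(see `Cruxes/PumpTransfer/Disproof.lean`, `-- Targets`).

References: T. Tao, JAMS 29 (2016), arXiv:1402.0290, §4 Lemma 4.1 (4.14) [Tao2016AveragedNS].
-/

noncomputable section

-- the nested summit namespace is the tree's layout (D-0017)
set_option linter.dupNamespace false

namespace Summit.NavierStokesRegularity.NavierStokesRegularity.Theorems.PumpTransfer.Negative

open MeasureTheory Set
open Literature.Analysis.FluidPDE Literature.Analysis.FluidPDE.Tao2016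

variable {ε₀ : ℝ} {m : ℕ}

/-- The circuit nonlinearity vanishes on the zero coefficient field. [folklore] -/
theorem quadTerm_zero (α : Fin m → Fin m → Fin m → ℤ × ℤ × ℤ → ℝ) (i : Fin m) (n : ℤ) (t : ℝ) :
    TaoCascade.quadTerm ε₀ α (fun (_ : Fin m) (_ : ℤ) (_ : ℝ) => (0 : ℝ)) i n t = 0 := by
  simp [TaoCascade.quadTerm]

/-- The heat fibre with zero datum and zero forcing vanishes. [folklore] -/
theorem duhamelScalar_zero_zero (L t : ℝ) : duhamelScalar 0 (fun _ : ℝ => (0 : ℝ)) L t = 0 := by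
  simp [duhamelScalar]

/-- **`X ≡ 0` solves the lifted Volterra system of the ray datum `A • ψ_{i₀,n₀}` when `A = 0`**, on
every time set, with every weighted bound. [folklore] -/
theorem volterra_zero_solution (𝒟 : CascadeWaveletData ε₀ m)
    (α : Fin m → Fin m → Fin m → ℤ × ℤ × ℤ → ℝ) (i₀ : Fin m) (n₀ : ℤ) (i : Fin m) (n : ℤ) (t : ℝ) :
    (fun (_ : Fin m) (_ : ℤ) (_ : ℝ) => (0 : ℝ)) i n t =
      ∫ ξ : EuclideanSpace ℝ (Fin 3), duhamelScalar ((0 : ℝ) * modeDelta i₀ i n₀ n)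
        (fun s => TaoCascade.quadTerm ε₀ α (fun (_ : Fin m) (_ : ℤ) (_ : ℝ) => (0 : ℝ)) i n (max s 0))
        (heatRate ξ) t * modeWeight 𝒟 i n ξ := by
  simp only [zero_mul]
  have h : ∀ ξ : EuclideanSpace ℝ (Fin 3), duhamelScalar 0
      (fun s => TaoCascade.quadTerm ε₀ α (fun (_ : Fin m) (_ : ℤ) (_ : ℝ) => (0 : ℝ)) i n (max s 0))
      (heatRate ξ) t = 0 := by
    intro ξ
    have : (fun s => TaoCascade.quadTerm ε₀ α (fun (_ : Fin m) (_ : ℤ) (_ : ℝ) => (0 : ℝ)) i n (max s 0))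
        = fun _ : ℝ => (0 : ℝ) := by
      funext s; exact quadTerm_zero α i n (max s 0)
    rw [this, duhamelScalar_zero_zero]
  simp [h]

/-- **Any witness of `stub_rayTypeI` has `A ≠ 0`**: for `A = 0` the non-extension clause (ii) fails on
every `[0,S)` — the zero field is a continuous, `H¹⁰`-weight-bounded Volterra solution there. Stated as
the negation of clause (ii) at `A = 0` for arbitrary data. [folklore] -/
theorem rayTypeI_clause_ii_fails_at_zero (𝒟 : CascadeWaveletData ε₀ m)
    (α : Fin m → Fin m → Fin m → ℤ × ℤ × ℤ → ℝ) (i₀ : Fin m) (n₀ : ℤ) (S : ℝ) :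
    ∃ X : Fin m → ℤ → ℝ → ℝ, (∀ (i : Fin m) (n : ℤ), Continuous (X i n)) ∧
      (∀ (i : Fin m) (n : ℤ), ∀ t ∈ Ico (0 : ℝ) S, X i n t =
        ∫ ξ : EuclideanSpace ℝ (Fin 3), duhamelScalar ((0 : ℝ) * modeDelta i₀ i n₀ n)
          (fun s => TaoCascade.quadTerm ε₀ α X i n (max s 0)) (heatRate ξ) t * modeWeight 𝒟 i n ξ) ∧
      (∀ S' ∈ Ico (0 : ℝ) S, ∃ C : ℝ, ∀ (i : Fin m) (n : ℤ), ∀ t ∈ Icc (0 : ℝ) S',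
        (1 + ((1 + ε₀) ^ n) ^ 10) * |X i n t| ≤ C) :=
  ⟨fun _ _ _ => 0, fun _ _ => continuous_const,
    fun i n t _ => volterra_zero_solution 𝒟 α i₀ n₀ i n t,
    fun _ _ => ⟨0, fun i n t _ => by simp⟩⟩

/-- **Any witness of `stub_rayTypeI` has `m ≥ 1`**: for `m = 0` the mode type `Fin 0` is empty, the
(unique, empty) coefficient field solves everything vacuously on every `[0,S)`, so clause (ii) fails.
[folklore] -/
theorem rayTypeI_clause_ii_fails_at_m_zero {ε₀ : ℝ} (𝒟 : CascadeWaveletData ε₀ 0)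
    (α : Fin 0 → Fin 0 → Fin 0 → ℤ × ℤ × ℤ → ℝ) (i₀ : Fin 0) (n₀ : ℤ) (A S : ℝ) :
    ∃ X : Fin 0 → ℤ → ℝ → ℝ, (∀ (i : Fin 0) (n : ℤ), Continuous (X i n)) ∧
      (∀ (i : Fin 0) (n : ℤ), ∀ t ∈ Ico (0 : ℝ) S, X i n t =
        ∫ ξ : EuclideanSpace ℝ (Fin 3), duhamelScalar (A * modeDelta i₀ i n₀ n)
          (fun s => TaoCascade.quadTerm ε₀ α X i n (max s 0)) (heatRate ξ) t * modeWeight 𝒟 i n ξ) ∧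
      (∀ S' ∈ Ico (0 : ℝ) S, ∃ C : ℝ, ∀ (i : Fin 0) (n : ℤ), ∀ t ∈ Icc (0 : ℝ) S',
        (1 + ((1 + ε₀) ^ n) ^ 10) * |X i n t| ≤ C) :=
  i₀.elim0

end Summit.NavierStokesRegularity.NavierStokesRegularity.Theorems.PumpTransfer.Negative

end
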